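import Summits.HodgeConjecture.CorCM.HypLiu418.A3Liu418GSCentralAction
import Literature.RepresentationTheory.CentralTorusWeightDecomposition
import Literature.NumberTheory.Automorphic.Liu2021.AppendixC.Thm415Pinned
import HarnessLib

/-!
# The central weight decomposition of `ℚ_ℓ^{ac} ⊗ H¹_ét` of the GS curve tower at the face: projections inside the Hom-space,
# Galois commutation, eigenvectors, automorphic and continuous occurring characters

Summit `HodgeConjecture`, sub-problem `CorCM`, crux `HLiu418`, line `a3_liu418` (GS-6, see-saw decomposition at the face);
namespace `Summit.HodgeConjecture.CorCM.Lines.A3Liu418`.  Sequel of `A3Liu418GSCentralAction` (`rhoEtCenterGS[Ext]`, finite-index /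
open stabilisers, automorphic support) over the generic `CentralTorusWeightDecomposition` (`weightProj ρ hfix ψ`, `weightProj_comm`,
`weightProj_apply_mem`, `exists_finset_sum_weightProj`) and `Thm415Pinned` (`EtaleHeckeDatum.omegaHom`, `mem_omegaHom_iff`).
Two `def`s with body (`psiTilde`, `chiOfWeight` — the `Chi`-packaging of an occurring central character) and THEOREMS; no named fact,
no instance, no `sorry`.

Setting: the GS curve record `S hU7ₛ hLQ h4 isoₛ`, a prime `ℓ`, `ι′ : ℂ ≃+* ℚ_ℓ^{ac}`, the étale Hecke datum
`X := etaleHeckeDatumGS S hU7ₛ hLQ h4 isoₛ ℓ`, the finite-adelic centre `Zc := finAdelicCenter F⁺ F c 2 J⋆` (`E¹(𝔸_{F⁺,f}) → U(J⋆)(𝔸_f)`),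
its action `ρZ := rhoEtCenterGSExt … (AlgebraicClosure ℚ_[ℓ])` on `E := ℚ_ℓ^{ac} ⊗ H¹_ét`, the weight projections `weightProj ρZ hfix ψ`
for `hfix := exists_finiteIndex_forall_rhoEtCenterGSExt_eq …`, and a member `f′ ∈ X.omegaHom ι′ ρ` of the Hom-space for ANY
`ρ : Representation ℂ (U(J⋆)(𝔸_f)) W`.
* §1 (f2) `omegaHom_central` (the centre acts on Hom-space values through `ρZ`) · (f3a) `commute_baseChange_rhoEt_rhoEtCenterGSExt`
  (Hecke operators commute with the centre) · (f3a′) **`weightProj_comp_mem_omegaHom`** (`p_ψ ∘ f′` stays in the Hom-space) ·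
  (f3b) **`weightProj_baseChange_towerRep`** (`p_ψ` commutes with Galois) · (f3c) `rhoEtCenterGSExt_weightProj` (projected values are
  `ψ`-eigenvectors) · (f4) **`omegaHom_sum_proj`** (every value is the finite sum of its weight components) · (f5)
  **`eq_one_of_weightProj_ne_zero`** (occurring `ψ` are trivial on `E¹(F⁺)`) · (f5′) `isOpen_ker_of_weightProj_ne_zero` (and on an open
  subgroup);
* §2 `weightProj_baseChange_rhoEt` (hPT), `rhoEt_finAdelicCenter_baseChange_weightProj` (hPz), `MonoidHom.continuous_of_forall_mem_eq_one`,
  **`psiTilde`**, `isAutomorphicOneChar_psiTilde`, **`chiOfWeight`** (`ψ̃ := ι′⁻¹ ∘ ψ` as a `Chi`), `chiOfWeight_val`.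
This is the `H¹`-side of the clause «`H¹_ét(Sh⋆) ⊗ ℚ_ℓ^{ac}` decomposes under the centre into finitely many automorphic characters,
compatibly with Hecke and Galois» in the proof of [Liu2021] Thm. 4.15 (l. 2199–2212).  HC_CM is not mentioned by this file.

## References
* [Liu2021] Y. Liu, Camb. J. Math. 9 (2021): §4.2 (FJcycle.tex l. 2158–2165; print pp. 49–50), Def. 4.11 (l. 2090), proof of
  Thm. 4.15 (l. 2199–2212; print pp. 50–51).
* [GelbartRogawski1991] S. Gelbart, J. Rogawski, Invent. Math. 105 (1991), §3.1 p. 454 (isotypic decomposition under the centre).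
* [Mok2014] C. P. Mok, Mem. AMS 235 (2015), §1 Notation p. 5.
-/

set_option autoImplicit false

noncomputable section

/-! ## §1. The face: the central weight projections act inside the Hom-space, commute with Hecke and Galois, and cut out eigenvectors -/

namespace Summit.HodgeConjecture.CorCM.Lines.A3Liu418

open CategoryTheory NumberField IsDedekindDomain
open scoped TensorProduct Classical
open Literature.AlgebraicGeometry.Motives
open Literature.AlgebraicGeometry.ShimuraVarieties.UnitaryCanonicalModel
open Literature.NumberTheory.Automorphic Literature.NumberTheory.Automorphic.UnitaryGroup
open Literature.NumberTheory.Automorphic.Liu2021 Literature.NumberTheory.Automorphic.Liu2021.AppendixC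
open Summit.HodgeConjecture.CorCM.Model Summit.HodgeConjecture.CorCM.Model.HComp
open Literature.RepresentationTheory

section Face

variable {F : CMField} {ι₁ : F →+* ℂ} {Jstar : Matrix (Fin 2) (Fin 2) F}
  {K₀ : C5.OpenCompactSubgroup ↥(finAdelic (↥(maximalRealSubfield F)) F (IsCMField.complexConj F) 2 Jstar)}
  (S : RecordSystemGS F Jstar ι₁ K₀)
  (hU7ₛ : S.HeckeTranslateDefinedOver) (hLQ : S.IsLevelQuotient) (h4 : 4 ≤ Module.finrank ℚ F) (isoₛ : ℕ → Prop)
  (ℓ : ℕ) [Fact ℓ.Prime] (ι' : ℂ ≃+* AlgebraicClosure ℚ_[ℓ])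
  {W : Type} [AddCommGroup W] [Module ℂ W]
  (ρ : Representation ℂ ↥(finAdelic (↥(maximalRealSubfield F)) F (IsCMField.complexConj F) 2 Jstar) W)

/-- **(f2) `omegaHom_central`** — the centre acts on Hom-space VALUES through `ρZ`: for `f′ ∈ Hom_{U(J⋆)(𝔸_f)}(ι′ ∘ ρ, ℚ_ℓ^{ac} ⊗ H¹_ét)`,
`u ∈ E¹(𝔸_{F⁺,f})`, `w ∈ W`: `f′ (ρ (u·1₂) w) = ρZ u (f′ w)` (the defining intertwining relation of ★ `omegaHom` at `g := Zc u`; `ρZ u`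
IS `rhoEt (Zc u) ⊗ 1` by `rfl`). [cite: Liu2021, §4.2 (FJcycle.tex l. 2162–2165; print pp. 49–50); proof of Thm. 4.15 (l. 2199–2212)] -/
theorem omegaHom_central
    {f' : W →ₛₗ[(ι' : ℂ →+* AlgebraicClosure ℚ_[ℓ])] AlgebraicClosure ℚ_[ℓ] ⊗[ℚ_[ℓ]] (sec42DataGS S h4 isoₛ).etaleH1Tower ℓ}
    (hf' : f' ∈ (etaleHeckeDatumGS S hU7ₛ hLQ h4 isoₛ ℓ).omegaHom ι' ρ)
    (u : ↥(finAdelicOne (↥(maximalRealSubfield (F : Type))) (F : Type) (IsCMField.complexConj (F : Type)))) (w : W) :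
    f' (ρ (finAdelicCenter (↥(maximalRealSubfield (F : Type))) (F : Type) (IsCMField.complexConj (F : Type)) 2 Jstar u) w) =
      rhoEtCenterGSExt S hU7ₛ hLQ h4 isoₛ ℓ (AlgebraicClosure ℚ_[ℓ]) u (f' w) :=
  ((etaleHeckeDatumGS S hU7ₛ hLQ h4 isoₛ ℓ).mem_omegaHom_iff ι' ρ f').1 hf' _ w

/-- `ρZ u` is `rhoEtCenterGS u ⊗ 1` (= `rhoEt (u·1₂) ⊗ 1`; unfolding of `rhoEtCenterGSExt = repBaseChange _ rhoEtCenterGS`, by `rfl`). [cite: Liu2021, §4.2 (FJcycle.tex l. 2160; print pp. 49–50)] -/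
theorem rhoEtCenterGSExt_eq_baseChange (u : ↥(finAdelicOne (↥(maximalRealSubfield (F : Type))) (F : Type) (IsCMField.complexConj (F : Type)))) :
    rhoEtCenterGSExt S hU7ₛ hLQ h4 isoₛ ℓ (AlgebraicClosure ℚ_[ℓ]) u =
      (rhoEtCenterGS S hU7ₛ hLQ h4 isoₛ ℓ u).baseChange (AlgebraicClosure ℚ_[ℓ]) :=
  rfl

/-- Generic: base change to `A` preserves commutation of endomorphisms (`(f ∘ g) ⊗ 1 = (f ⊗ 1) ∘ (g ⊗ 1)`, `LinearMap.baseChange_comp`). [folklore] -/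
theorem _root_.LinearMap.commute_baseChange_of_commute {R : Type*} [CommSemiring R] (A : Type*) [CommSemiring A] [Algebra R A]
    {M : Type*} [AddCommMonoid M] [Module R M] {f g : M →ₗ[R] M} (h : Commute f g) :
    Commute (f.baseChange A) (g.baseChange A) := by
  change f.baseChange A ∘ₗ g.baseChange A = g.baseChange A ∘ₗ f.baseChange A
  rw [← LinearMap.baseChange_comp, ← LinearMap.baseChange_comp]
  exact congrArg (LinearMap.baseChange A) h

/-- (f3a₀) on `H¹_ét` itself: the Hecke operator `rhoEt g` commutes with the central operator `rhoEtCenterGS u = rhoEt (u·1₂)` (`u·1₂` is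
central in `U(J⋆)(𝔸_f)`, ★ `finAdelicCenter_mul_comm`; `rhoEt` is a homomorphism). [cite: Liu2021, §4.2 (FJcycle.tex l. 2160; print pp. 49–50)] [cite: Mok2014, §1 Notation p. 5] -/
theorem rhoEt_rhoEtCenterGS_comm (g : ↥(finAdelic (↥(maximalRealSubfield F)) F (IsCMField.complexConj F) 2 Jstar))
    (u : ↥(finAdelicOne (↥(maximalRealSubfield (F : Type))) (F : Type) (IsCMField.complexConj (F : Type))))
    (y : (sec42DataGS S h4 isoₛ).etaleH1Tower ℓ) :
    (etaleHeckeDatumGS S hU7ₛ hLQ h4 isoₛ ℓ).rhoEt g (rhoEtCenterGS S hU7ₛ hLQ h4 isoₛ ℓ u y) =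
      rhoEtCenterGS S hU7ₛ hLQ h4 isoₛ ℓ u ((etaleHeckeDatumGS S hU7ₛ hLQ h4 isoₛ ℓ).rhoEt g y) := by
  have h := LinearMap.congr_fun ((map_mul (etaleHeckeDatumGS S hU7ₛ hLQ h4 isoₛ ℓ).rhoEt g
    (finAdelicCenter (↥(maximalRealSubfield (F : Type))) (F : Type) (IsCMField.complexConj (F : Type)) 2 Jstar u)).symm.trans
    ((congrArg (etaleHeckeDatumGS S hU7ₛ hLQ h4 isoₛ ℓ).rhoEt
      (finAdelicCenter_mul_comm (↥(maximalRealSubfield (F : Type))) (F : Type) (IsCMField.complexConj (F : Type)) 2 Jstar u g).symm).trans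
      (map_mul (etaleHeckeDatumGS S hU7ₛ hLQ h4 isoₛ ℓ).rhoEt _ g))) y
  exact h

/-- **(f3a) the Hecke operators `rhoEt g ⊗ 1` commute with the central action `ρZ u`** on `ℚ_ℓ^{ac} ⊗ H¹_ét` ((f3a₀) based-changed, `LinearMap.commute_baseChange_of_commute`).
[cite: Liu2021, §4.2 (FJcycle.tex l. 2160–2165; print pp. 49–50)] -/
theorem commute_baseChange_rhoEt_rhoEtCenterGSExt (g : ↥(finAdelic (↥(maximalRealSubfield F)) F (IsCMField.complexConj F) 2 Jstar))
    (u : ↥(finAdelicOne (↥(maximalRealSubfield (F : Type))) (F : Type) (IsCMField.complexConj (F : Type)))) :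
    Commute (((etaleHeckeDatumGS S hU7ₛ hLQ h4 isoₛ ℓ).rhoEt g).baseChange (AlgebraicClosure ℚ_[ℓ]))
      (rhoEtCenterGSExt S hU7ₛ hLQ h4 isoₛ ℓ (AlgebraicClosure ℚ_[ℓ]) u) := by
  rw [rhoEtCenterGSExt_eq_baseChange]
  exact LinearMap.commute_baseChange_of_commute (AlgebraicClosure ℚ_[ℓ])
    (LinearMap.ext fun y => rhoEt_rhoEtCenterGS_comm S hU7ₛ hLQ h4 isoₛ ℓ g u y)

/-- **(f3a′) the projected maps stay in the Hom-space**: for every character `ψ` of the finite-adelic centre, `weightProj ρZ hfix ψ ∘ f′` is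
again `U(J⋆)(𝔸_f)`-equivariant, i.e. lies in `X.omegaHom ι′ ρ` (`weightProj_comm` with `rhoEt g ⊗ 1`, which commutes with the
centre by (f3a)). [cite: Liu2021, proof of Thm. 4.15 (FJcycle.tex l. 2199–2212)] [cite: GelbartRogawski1991, §3.1 p. 454] -/
theorem weightProj_comp_mem_omegaHom
    {f' : W →ₛₗ[(ι' : ℂ →+* AlgebraicClosure ℚ_[ℓ])] AlgebraicClosure ℚ_[ℓ] ⊗[ℚ_[ℓ]] (sec42DataGS S h4 isoₛ).etaleH1Tower ℓ}
    (hf' : f' ∈ (etaleHeckeDatumGS S hU7ₛ hLQ h4 isoₛ ℓ).omegaHom ι' ρ)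
    (ψ : ↥(finAdelicOne (↥(maximalRealSubfield (F : Type))) (F : Type) (IsCMField.complexConj (F : Type))) →* (AlgebraicClosure ℚ_[ℓ])ˣ) :
    (weightProj (rhoEtCenterGSExt S hU7ₛ hLQ h4 isoₛ ℓ (AlgebraicClosure ℚ_[ℓ]))
        (exists_finiteIndex_forall_rhoEtCenterGSExt_eq S hU7ₛ hLQ h4 isoₛ ℓ (AlgebraicClosure ℚ_[ℓ])) ψ).comp f' ∈
      (etaleHeckeDatumGS S hU7ₛ hLQ h4 isoₛ ℓ).omegaHom ι' ρ := by
  refine ((etaleHeckeDatumGS S hU7ₛ hLQ h4 isoₛ ℓ).mem_omegaHom_iff ι' ρ _).2 fun g w => ?_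
  have h1 := ((etaleHeckeDatumGS S hU7ₛ hLQ h4 isoₛ ℓ).mem_omegaHom_iff ι' ρ f').1 hf' g w
  have h2 := weightProj_comm _ (exists_finiteIndex_forall_rhoEtCenterGSExt_eq S hU7ₛ hLQ h4 isoₛ ℓ (AlgebraicClosure ℚ_[ℓ])) _
    (fun u => commute_baseChange_rhoEt_rhoEtCenterGSExt S hU7ₛ hLQ h4 isoₛ ℓ g u) ψ (f' w)
  exact (congrArg (weightProj (rhoEtCenterGSExt S hU7ₛ hLQ h4 isoₛ ℓ (AlgebraicClosure ℚ_[ℓ]))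
    (exists_finiteIndex_forall_rhoEtCenterGSExt_eq S hU7ₛ hLQ h4 isoₛ ℓ (AlgebraicClosure ℚ_[ℓ])) ψ) h1).trans h2

/-- **(f3b) the weight projections commute with the Galois action `towerRep σ ⊗ 1`** (Hecke and Galois commute, field `EtaleHeckeDatum.comm`;
the commutation `Commute ((towerRep σ) ⊗ 1) (ρZ u)` is `EtaleHeckeDatum.comm` base-changed). [cite: Liu2021, §4.2 (FJcycle.tex l. 2158–2165; print pp. 49–50): «`ℚ_ℓ^{ac}[Gal(ℂ/τ′(E)) × 𝔾(𝔸_F^∞)]`-module»] -/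
theorem weightProj_baseChange_towerRep (σ : Field.absoluteGaloisGroup (F : Type))
    (ψ : ↥(finAdelicOne (↥(maximalRealSubfield (F : Type))) (F : Type) (IsCMField.complexConj (F : Type))) →* (AlgebraicClosure ℚ_[ℓ])ˣ)
    (v : AlgebraicClosure ℚ_[ℓ] ⊗[ℚ_[ℓ]] (sec42DataGS S h4 isoₛ).etaleH1Tower ℓ) :
    weightProj (rhoEtCenterGSExt S hU7ₛ hLQ h4 isoₛ ℓ (AlgebraicClosure ℚ_[ℓ]))
        (exists_finiteIndex_forall_rhoEtCenterGSExt_eq S hU7ₛ hLQ h4 isoₛ ℓ (AlgebraicClosure ℚ_[ℓ])) ψ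
        (((sec42DataGS S h4 isoₛ).towerRep ℓ σ).baseChange (AlgebraicClosure ℚ_[ℓ]) v) =
      ((sec42DataGS S h4 isoₛ).towerRep ℓ σ).baseChange (AlgebraicClosure ℚ_[ℓ])
        (weightProj (rhoEtCenterGSExt S hU7ₛ hLQ h4 isoₛ ℓ (AlgebraicClosure ℚ_[ℓ]))
          (exists_finiteIndex_forall_rhoEtCenterGSExt_eq S hU7ₛ hLQ h4 isoₛ ℓ (AlgebraicClosure ℚ_[ℓ])) ψ v) := by
  refine weightProj_comm _ _ _ (fun u => ?_) ψ v
  rw [rhoEtCenterGSExt_eq_baseChange]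
  exact LinearMap.commute_baseChange_of_commute (AlgebraicClosure ℚ_[ℓ])
    (LinearMap.ext fun y => ((etaleHeckeDatumGS S hU7ₛ hLQ h4 isoₛ ℓ).comm _ σ y).symm)

/-- **(f3c) each projected value is a `ψ`-EIGENVECTOR of the centre**: `ρZ u (weightProj ψ v) = ψ u • weightProj ψ v`
(`weightProj_apply_mem` + ★ `mem_weightSpace`). [cite: GelbartRogawski1991, §3.1 p. 454] -/
theorem rhoEtCenterGSExt_weightProj
    (ψ : ↥(finAdelicOne (↥(maximalRealSubfield (F : Type))) (F : Type) (IsCMField.complexConj (F : Type))) →* (AlgebraicClosure ℚ_[ℓ])ˣ)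
    (u : ↥(finAdelicOne (↥(maximalRealSubfield (F : Type))) (F : Type) (IsCMField.complexConj (F : Type))))
    (v : AlgebraicClosure ℚ_[ℓ] ⊗[ℚ_[ℓ]] (sec42DataGS S h4 isoₛ).etaleH1Tower ℓ) :
    rhoEtCenterGSExt S hU7ₛ hLQ h4 isoₛ ℓ (AlgebraicClosure ℚ_[ℓ]) u
        (weightProj (rhoEtCenterGSExt S hU7ₛ hLQ h4 isoₛ ℓ (AlgebraicClosure ℚ_[ℓ]))
          (exists_finiteIndex_forall_rhoEtCenterGSExt_eq S hU7ₛ hLQ h4 isoₛ ℓ (AlgebraicClosure ℚ_[ℓ])) ψ v) =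
      ((ψ u : (AlgebraicClosure ℚ_[ℓ])ˣ) : AlgebraicClosure ℚ_[ℓ]) •
        weightProj (rhoEtCenterGSExt S hU7ₛ hLQ h4 isoₛ ℓ (AlgebraicClosure ℚ_[ℓ]))
          (exists_finiteIndex_forall_rhoEtCenterGSExt_eq S hU7ₛ hLQ h4 isoₛ ℓ (AlgebraicClosure ℚ_[ℓ])) ψ v :=
  mem_weightSpace.1 (weightProj_apply_mem _ _ ψ v) u

/-- **(f4) `omegaHom_sum_proj`** — every Hom-space value is the FINITE sum of its central weight components
(`exists_finset_sum_weightProj`, hypothesis (b) = `exists_finiteIndex_forall_rhoEtCenterGSExt_eq`).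
[cite: Liu2021, proof of Thm. 4.15 (FJcycle.tex l. 2199–2212)] [cite: GelbartRogawski1991, §3.1 p. 454] -/
theorem omegaHom_sum_proj
    (f' : W →ₛₗ[(ι' : ℂ →+* AlgebraicClosure ℚ_[ℓ])] AlgebraicClosure ℚ_[ℓ] ⊗[ℚ_[ℓ]] (sec42DataGS S h4 isoₛ).etaleH1Tower ℓ) (w : W) :
    ∃ s : Finset (↥(finAdelicOne (↥(maximalRealSubfield (F : Type))) (F : Type) (IsCMField.complexConj (F : Type))) →* (AlgebraicClosure ℚ_[ℓ])ˣ),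
      (∀ ψ, ψ ∉ s → weightProj (rhoEtCenterGSExt S hU7ₛ hLQ h4 isoₛ ℓ (AlgebraicClosure ℚ_[ℓ]))
          (exists_finiteIndex_forall_rhoEtCenterGSExt_eq S hU7ₛ hLQ h4 isoₛ ℓ (AlgebraicClosure ℚ_[ℓ])) ψ (f' w) = 0) ∧
        ∑ ψ ∈ s, weightProj (rhoEtCenterGSExt S hU7ₛ hLQ h4 isoₛ ℓ (AlgebraicClosure ℚ_[ℓ]))
          (exists_finiteIndex_forall_rhoEtCenterGSExt_eq S hU7ₛ hLQ h4 isoₛ ℓ (AlgebraicClosure ℚ_[ℓ])) ψ (f' w) = f' w :=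
  exists_finset_sum_weightProj _ _ (f' w)

/-- **(f5) automorphic support** — a character `ψ` of the finite-adelic centre with a NON-ZERO projected value `weightProj ψ (f′ w) ≠ 0` is
trivial on every rational norm-one `(x)`, `x ∈ E¹(F⁺)` (`eq_one_of_eigenvector_rhoEtCenterGSExt` applied to the eigenvector of
(f3c)) — the triviality clause of ★ `IsAutomorphicOneChar`; with (f5′) the character `ι′⁻¹ ∘ ψ` is a `Chi` and `ω⋆(ψ̃-package)` is a genuine
[Def 4.11] carrier, so `hD6` applies slice-wise. [cite: Liu2021, proof of Thm. 4.15 (FJcycle.tex l. 2199–2212); Def. 4.11 (l. 2090)] -/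
theorem eq_one_of_weightProj_ne_zero
    (ψ : ↥(finAdelicOne (↥(maximalRealSubfield (F : Type))) (F : Type) (IsCMField.complexConj (F : Type))) →* (AlgebraicClosure ℚ_[ℓ])ˣ)
    {v : AlgebraicClosure ℚ_[ℓ] ⊗[ℚ_[ℓ]] (sec42DataGS S h4 isoₛ).etaleH1Tower ℓ}
    (hv : weightProj (rhoEtCenterGSExt S hU7ₛ hLQ h4 isoₛ ℓ (AlgebraicClosure ℚ_[ℓ]))
        (exists_finiteIndex_forall_rhoEtCenterGSExt_eq S hU7ₛ hLQ h4 isoₛ ℓ (AlgebraicClosure ℚ_[ℓ])) ψ v ≠ 0)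
    (x : (F : Type)ˣ)
    (hx : Units.map (algebraMap (F : Type) (FiniteAdeleRing (𝓞 (F : Type)) (F : Type))).toMonoidHom x ∈
      finAdelicOne (↥(maximalRealSubfield (F : Type))) (F : Type) (IsCMField.complexConj (F : Type))) :
    ψ ⟨_, hx⟩ = 1 :=
  eq_one_of_eigenvector_rhoEtCenterGSExt S hU7ₛ hLQ h4 isoₛ ℓ (AlgebraicClosure ℚ_[ℓ]) ψ hv
    (fun u => rhoEtCenterGSExt_weightProj S hU7ₛ hLQ h4 isoₛ ℓ ψ u v) x hx
/-- **(f5′) continuity**: a character of the finite-adelic centre occurring in `ℚ_ℓ^{ac} ⊗ H¹_ét` kills an OPEN subgroup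
(the centre meets every small level `K` in an open subgroup acting trivially on a `K`-fixed eigenvector, ★ `EtaleHeckeDatum.smooth`), hence is
locally constant; with (f5) it is an automorphic `Chi`.  Typed as the kernel-openness clause the `Chi` constructor wants. [cite: Liu2021, Def. 4.11 (l. 2090)] -/
theorem isOpen_ker_of_weightProj_ne_zero
    (ψ : ↥(finAdelicOne (↥(maximalRealSubfield (F : Type))) (F : Type) (IsCMField.complexConj (F : Type))) →* (AlgebraicClosure ℚ_[ℓ])ˣ)
    {v : AlgebraicClosure ℚ_[ℓ] ⊗[ℚ_[ℓ]] (sec42DataGS S h4 isoₛ).etaleH1Tower ℓ}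
    (hv : weightProj (rhoEtCenterGSExt S hU7ₛ hLQ h4 isoₛ ℓ (AlgebraicClosure ℚ_[ℓ]))
        (exists_finiteIndex_forall_rhoEtCenterGSExt_eq S hU7ₛ hLQ h4 isoₛ ℓ (AlgebraicClosure ℚ_[ℓ])) ψ v ≠ 0) :
    ∃ U : Subgroup ↥(finAdelicOne (↥(maximalRealSubfield (F : Type))) (F : Type) (IsCMField.complexConj (F : Type))),
      IsOpen (U : Set ↥(finAdelicOne (↥(maximalRealSubfield (F : Type))) (F : Type) (IsCMField.complexConj (F : Type)))) ∧ ∀ u ∈ U, ψ u = 1 := by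
  -- the non-zero eigenvector `p_ψ v` ((f3c)) is fixed by an OPEN subgroup of the centre, on which `ψ = 1`.
  obtain ⟨U, hU, h⟩ := exists_isOpen_forall_rhoEtCenterGSExt_eq S hU7ₛ hLQ h4 isoₛ ℓ (AlgebraicClosure ℚ_[ℓ]) _
  exact ⟨U, hU, fun u hu => eq_one_of_eigenvector_of_apply_eq S hU7ₛ hLQ h4 isoₛ ℓ (AlgebraicClosure ℚ_[ℓ]) ψ hv
    (fun u => rhoEtCenterGSExt_weightProj S hU7ₛ hLQ h4 isoₛ ℓ ψ u v) (h u hu)⟩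

end Face

end Summit.HodgeConjecture.CorCM.Lines.A3Liu418

/-! ## §2. The `H¹`-side hypotheses of the per-label factorisation (`P := weightProj ρZ hfix ψ`, `zc := finAdelicCenter`, `c := 1`)
and the `Chi`-packaging `ψ̃ := ι′⁻¹ ∘ ψ` of an occurring central character (automorphic by (f5), continuous by (f5′)). -/

namespace Summit.HodgeConjecture.CorCM.Lines.A3Liu418

open CategoryTheory NumberField IsDedekindDomain
open scoped TensorProduct Classical
open Literature.AlgebraicGeometry.Motives
open Literature.AlgebraicGeometry.ShimuraVarieties.UnitaryCanonicalModel
open Literature.NumberTheory.Automorphic Literature.NumberTheory.Automorphic.UnitaryGroup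
open Literature.NumberTheory.Automorphic.Liu2021 Literature.NumberTheory.Automorphic.Liu2021.AppendixC
open Summit.HodgeConjecture.CorCM.Model Summit.HodgeConjecture.CorCM.Model.HComp
open Literature.RepresentationTheory

section FaceH1

variable {F : CMField} {ι₁ : F →+* ℂ} {Jstar : Matrix (Fin 2) (Fin 2) F}
  {K₀ : C5.OpenCompactSubgroup ↥(finAdelic (↥(maximalRealSubfield F)) F (IsCMField.complexConj F) 2 Jstar)}
  (S : RecordSystemGS F Jstar ι₁ K₀)
  (hU7ₛ : S.HeckeTranslateDefinedOver) (hLQ : S.IsLevelQuotient) (h4 : 4 ≤ Module.finrank ℚ F) (isoₛ : ℕ → Prop)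
  (ℓ : ℕ) [Fact ℓ.Prime] (ι' : ℂ ≃+* AlgebraicClosure ℚ_[ℓ])

/-- **hPT at the face**: the weight projection `p_ψ` commutes with every Hecke operator `rhoEt g ⊗ 1` ((f3a) + `weightProj_comm`).
[cite: Liu2021, proof of Thm. 4.15 (FJcycle.tex l. 2199–2212)] -/
theorem weightProj_baseChange_rhoEt
    (ψ : ↥(finAdelicOne (↥(maximalRealSubfield (F : Type))) (F : Type) (IsCMField.complexConj (F : Type))) →* (AlgebraicClosure ℚ_[ℓ])ˣ)
    (g : ↥(finAdelic (↥(maximalRealSubfield F)) F (IsCMField.complexConj F) 2 Jstar))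
    (x : AlgebraicClosure ℚ_[ℓ] ⊗[ℚ_[ℓ]] (sec42DataGS S h4 isoₛ).etaleH1Tower ℓ) :
    weightProj (rhoEtCenterGSExt S hU7ₛ hLQ h4 isoₛ ℓ (AlgebraicClosure ℚ_[ℓ]))
        (exists_finiteIndex_forall_rhoEtCenterGSExt_eq S hU7ₛ hLQ h4 isoₛ ℓ (AlgebraicClosure ℚ_[ℓ])) ψ
        ((((etaleHeckeDatumGS S hU7ₛ hLQ h4 isoₛ ℓ).rhoEt g).baseChange (AlgebraicClosure ℚ_[ℓ])) x) =
      (((etaleHeckeDatumGS S hU7ₛ hLQ h4 isoₛ ℓ).rhoEt g).baseChange (AlgebraicClosure ℚ_[ℓ]))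
        (weightProj (rhoEtCenterGSExt S hU7ₛ hLQ h4 isoₛ ℓ (AlgebraicClosure ℚ_[ℓ]))
          (exists_finiteIndex_forall_rhoEtCenterGSExt_eq S hU7ₛ hLQ h4 isoₛ ℓ (AlgebraicClosure ℚ_[ℓ])) ψ x) :=
  weightProj_comm _ _ _ (fun u => commute_baseChange_rhoEt_rhoEtCenterGSExt S hU7ₛ hLQ h4 isoₛ ℓ g u) ψ x

/-- **`ψ̃ := ι′⁻¹ ∘ ψ`** — an `ℓ`-adic central character read back in `ℂˣ` through `ι′ : ℂ ≃ ℚ_ℓ^{ac}` (the label of the slice in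
print's currency). [cite: Liu2021, Def. 4.11 (l. 2090); proof of Thm. 4.15 (l. 2199–2212)] -/
def psiTilde (ψ : ↥(finAdelicOne (↥(maximalRealSubfield (F : Type))) (F : Type) (IsCMField.complexConj (F : Type))) →* (AlgebraicClosure ℚ_[ℓ])ˣ) :
    ↥(finAdelicOne (↥(maximalRealSubfield (F : Type))) (F : Type) (IsCMField.complexConj (F : Type))) →* ℂˣ :=
  (Units.map (ι'.symm : AlgebraicClosure ℚ_[ℓ] ≃+* ℂ).toRingHom.toMonoidHom).comp ψ

/-- `ι′ (ψ̃ u) = ψ u`. [cite: Liu2021, proof of Thm. 4.15 (l. 2199–2212)] -/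
theorem apply_psiTilde (ψ : ↥(finAdelicOne (↥(maximalRealSubfield (F : Type))) (F : Type) (IsCMField.complexConj (F : Type))) →* (AlgebraicClosure ℚ_[ℓ])ˣ)
    (u : ↥(finAdelicOne (↥(maximalRealSubfield (F : Type))) (F : Type) (IsCMField.complexConj (F : Type)))) :
    ι' ((psiTilde ℓ ι' ψ u : ℂˣ) : ℂ) = ((ψ u : (AlgebraicClosure ℚ_[ℓ])ˣ) : AlgebraicClosure ℚ_[ℓ]) := by
  rw [psiTilde, MonoidHom.comp_apply, Units.coe_map]
  exact ι'.apply_symm_apply _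

/-- **hPz at the face** (`c := 1`): `(rhoEt (u·1₂) ⊗ 1) (p_ψ x) = ι′ (ψ̃ u · 1) • p_ψ x` — (f3c) `rhoEtCenterGSExt_weightProj` read through
`ρZ u = rhoEt (Zc u) ⊗ 1` (`rfl`) and `ι′ ∘ ψ̃ = ψ`. [cite: Liu2021, proof of Thm. 4.15 (FJcycle.tex l. 2199–2212)] -/
theorem rhoEt_finAdelicCenter_baseChange_weightProj
    (ψ : ↥(finAdelicOne (↥(maximalRealSubfield (F : Type))) (F : Type) (IsCMField.complexConj (F : Type))) →* (AlgebraicClosure ℚ_[ℓ])ˣ)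
    (u : ↥(finAdelicOne (↥(maximalRealSubfield (F : Type))) (F : Type) (IsCMField.complexConj (F : Type))))
    (x : AlgebraicClosure ℚ_[ℓ] ⊗[ℚ_[ℓ]] (sec42DataGS S h4 isoₛ).etaleH1Tower ℓ) :
    (((etaleHeckeDatumGS S hU7ₛ hLQ h4 isoₛ ℓ).rhoEt
        (finAdelicCenter (↥(maximalRealSubfield (F : Type))) (F : Type) (IsCMField.complexConj (F : Type)) 2 Jstar u)).baseChange
          (AlgebraicClosure ℚ_[ℓ]))
        (weightProj (rhoEtCenterGSExt S hU7ₛ hLQ h4 isoₛ ℓ (AlgebraicClosure ℚ_[ℓ]))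
          (exists_finiteIndex_forall_rhoEtCenterGSExt_eq S hU7ₛ hLQ h4 isoₛ ℓ (AlgebraicClosure ℚ_[ℓ])) ψ x) =
      ι' (((psiTilde ℓ ι' ψ u : ℂˣ) : ℂ) * (((1 : ↥(finAdelicOne (↥(maximalRealSubfield (F : Type))) (F : Type)
          (IsCMField.complexConj (F : Type))) → ℂˣ) u : ℂˣ) : ℂ)) •
        weightProj (rhoEtCenterGSExt S hU7ₛ hLQ h4 isoₛ ℓ (AlgebraicClosure ℚ_[ℓ]))
          (exists_finiteIndex_forall_rhoEtCenterGSExt_eq S hU7ₛ hLQ h4 isoₛ ℓ (AlgebraicClosure ℚ_[ℓ])) ψ x :=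
  (rhoEtCenterGSExt_weightProj S hU7ₛ hLQ h4 isoₛ ℓ ψ u x).trans
    (congrArg (fun a : AlgebraicClosure ℚ_[ℓ] => a • weightProj (rhoEtCenterGSExt S hU7ₛ hLQ h4 isoₛ ℓ (AlgebraicClosure ℚ_[ℓ]))
        (exists_finiteIndex_forall_rhoEtCenterGSExt_eq S hU7ₛ hLQ h4 isoₛ ℓ (AlgebraicClosure ℚ_[ℓ])) ψ x)
      (by rw [Pi.one_apply, Units.val_one, mul_one, apply_psiTilde]))

/-- **a homomorphism out of a topological group that is `1` on an open subgroup is continuous** (locally constant). [folklore] -/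
theorem _root_.MonoidHom.continuous_of_forall_mem_eq_one {G M : Type*} [Group G] [TopologicalSpace G] [IsTopologicalGroup G]
    [Monoid M] [TopologicalSpace M] [ContinuousMul M] (f : G →* M) (U : Subgroup G) (hU : IsOpen (U : Set G))
    (h : ∀ u ∈ U, f u = 1) : Continuous f := by
  refine continuous_of_continuousAt_one f ?_
  rw [ContinuousAt, map_one]
  exact tendsto_const_nhds.congr' (Filter.eventually_of_mem (hU.mem_nhds U.one_mem) fun u hu => (h u hu).symm)

/-- **`ψ̃` of an OCCURRING `ψ` is an automorphic character (`∈ Chi`)**: continuous by (f5′) `isOpen_ker_of_weightProj_ne_zero`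
(trivial on an open subgroup of the centre), trivial on `E¹(F⁺) ⊂ E¹(𝔸_f)` by (f5) `eq_one_of_weightProj_ne_zero`.
[cite: Liu2021, Def. 4.11 (l. 2090); proof of Thm. 4.15 (l. 2199–2212)] -/
theorem isAutomorphicOneChar_psiTilde
    (ψ : ↥(finAdelicOne (↥(maximalRealSubfield (F : Type))) (F : Type) (IsCMField.complexConj (F : Type))) →* (AlgebraicClosure ℚ_[ℓ])ˣ)
    {v : AlgebraicClosure ℚ_[ℓ] ⊗[ℚ_[ℓ]] (sec42DataGS S h4 isoₛ).etaleH1Tower ℓ}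
    (hv : weightProj (rhoEtCenterGSExt S hU7ₛ hLQ h4 isoₛ ℓ (AlgebraicClosure ℚ_[ℓ]))
        (exists_finiteIndex_forall_rhoEtCenterGSExt_eq S hU7ₛ hLQ h4 isoₛ ℓ (AlgebraicClosure ℚ_[ℓ])) ψ v ≠ 0) :
    Def411WeilCarriers.IsAutomorphicOneChar (↥(maximalRealSubfield (F : Type))) (F : Type) (IsCMField.complexConj (F : Type))
      (psiTilde ℓ ι' ψ) := by
  obtain ⟨U, hU, hUψ⟩ := isOpen_ker_of_weightProj_ne_zero S hU7ₛ hLQ h4 isoₛ ℓ ψ hv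
  refine ⟨(psiTilde ℓ ι' ψ).continuous_of_forall_mem_eq_one U hU fun u hu => ?_, fun x hx => ?_⟩
  · rw [psiTilde, MonoidHom.comp_apply, hUψ u hu, map_one]
  · rw [psiTilde, MonoidHom.comp_apply, eq_one_of_weightProj_ne_zero S hU7ₛ hLQ h4 isoₛ ℓ ψ hv x hx, map_one]

/-- **the label `χc i : Chi` of the slice at an occurring `ψ`** (= `⟨ψ̃, automorphic⟩`). [cite: Liu2021, Def. 4.11 (l. 2090)] -/
def chiOfWeight
    (ψ : ↥(finAdelicOne (↥(maximalRealSubfield (F : Type))) (F : Type) (IsCMField.complexConj (F : Type))) →* (AlgebraicClosure ℚ_[ℓ])ˣ)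
    {v : AlgebraicClosure ℚ_[ℓ] ⊗[ℚ_[ℓ]] (sec42DataGS S h4 isoₛ).etaleH1Tower ℓ}
    (hv : weightProj (rhoEtCenterGSExt S hU7ₛ hLQ h4 isoₛ ℓ (AlgebraicClosure ℚ_[ℓ]))
        (exists_finiteIndex_forall_rhoEtCenterGSExt_eq S hU7ₛ hLQ h4 isoₛ ℓ (AlgebraicClosure ℚ_[ℓ])) ψ v ≠ 0) :
    Def411WeilCarriers.Chi (↥(maximalRealSubfield (F : Type))) (F : Type) (IsCMField.complexConj (F : Type)) :=
  ⟨psiTilde ℓ ι' ψ, isAutomorphicOneChar_psiTilde S hU7ₛ hLQ h4 isoₛ ℓ ι' ψ hv⟩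

/-- `(chiOfWeight … ψ hv).1 = ψ̃` (`rfl`). [cite: Liu2021, Def. 4.11 (l. 2090)] -/
theorem chiOfWeight_val
    (ψ : ↥(finAdelicOne (↥(maximalRealSubfield (F : Type))) (F : Type) (IsCMField.complexConj (F : Type))) →* (AlgebraicClosure ℚ_[ℓ])ˣ)
    {v : AlgebraicClosure ℚ_[ℓ] ⊗[ℚ_[ℓ]] (sec42DataGS S h4 isoₛ).etaleH1Tower ℓ}
    (hv : weightProj (rhoEtCenterGSExt S hU7ₛ hLQ h4 isoₛ ℓ (AlgebraicClosure ℚ_[ℓ]))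
        (exists_finiteIndex_forall_rhoEtCenterGSExt_eq S hU7ₛ hLQ h4 isoₛ ℓ (AlgebraicClosure ℚ_[ℓ])) ψ v ≠ 0) :
    (chiOfWeight S hU7ₛ hLQ h4 isoₛ ℓ ι' ψ hv).1 = psiTilde ℓ ι' ψ := rfl

end FaceH1

end Summit.HodgeConjecture.CorCM.Lines.A3Liu418

end
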